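import Summits.HubbardSuperconductivity.HubbardSuperconductivity.Theses.WeakCouplingBCS
import Literature.MathematicalPhysics.QuantumLattice.FockRelabel
import Literature.MathematicalPhysics.QuantumLattice.PairFieldMomentum
import Literature.Probability.LatticeModels.TorusFourierProofs
import HarnessLib

/-!
# r1 typing sketch — the TRANSVERSE core of child T is typeable today (corrects s2 census R4)

`fockTranslate v` (Literature/MathematicalPhysics/QuantumLattice/FockRelabel.lean, 2026-08-15) is the many-body
lattice translation unitary on `Fock (Orb (FermionTorus d L))`; it commutes with `hubbardTorus`
(`fockTranslate_commute_hubbardTorus`) and preserves `szSector` (`fockTranslate_mulVec_mem_szSector`). With it the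
strategist-s2 typing of child T's transverse part (S7: `T_a` momentum purity, `T_b` Landau floor) ELABORATES. These
are SIGNATURES ONLY (Props), deliberately NOT registered as stubs: none has a supplier (census r1 §Strengthen S-r1.3).
-/

noncomputable section

set_option linter.dupNamespace false

namespace Summit.HubbardSuperconductivity.HubbardSuperconductivity.Cruxes.WcbcsSsbToTorusLRO.StrategistR1

open Literature.MathematicalPhysics.QuantumLattice Literature.Probability.LatticeModels
open Filter Set Matrix
open scoped ComplexOrder

variable {L : ℕ} [NeZero L]

/-- The total-momentum-`P` subspace of Fock space: joint eigenvectors of the translations `U_v` with eigenvalue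
`χ_P(v)` (`torusChar P v`). -/
def momentumSubspace (L : ℕ) [NeZero L] (P : TorusSite 2 L) : Submodule ℂ (Fock (Orb (FermionTorus 2 L))) :=
  ⨅ v : TorusSite 2 L,
    LinearMap.ker (Matrix.toLin' (fockTranslate (d := 2) (L := L) v).val - torusChar P v • LinearMap.id)

/-- `T_a` (MOMENTUM PURITY, zero resolution): eventually along even sides, every ground state of the three sectors
`(N_L, 0)`, `(N_L ± 2, 0)` is translation invariant (total lattice momentum `0`). False at `U = 0` on open shells;
asserted only eventually in `L` at fixed `U > 0`. -/
def MomentumPurityAt (U δ : ℝ) : Prop :=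
  ∀ᶠ k : ℕ in atTop, ∀ j : Fin 3, ∀ ψ : Fock (Orb (FermionTorus 2 (2 * k + 1 + 1))),
    IsGroundStateInSector (hubbardTorus 2 (2 * k + 1 + 1) 1 U)
        (2 * ⌊(1 - δ) * ((2 * k + 1 + 1 : ℕ) : ℝ) ^ 2 / 2⌋₊ + 2 * (j : ℕ) - 2) 0 ψ →
      ∀ v : TorusSite 2 (2 * k + 1 + 1), (fockTranslate (d := 2) v).val *ᵥ ψ = ψ

/-- `T_b` (LANDAU FLOOR, `O(1/L)` resolution; sector ENERGIES only): a critical velocity `v > 0` below momentum `η`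
in the two neighbouring sectors — the lowest energy at total momentum `P ≠ 0`, `|P| < η`, lies at least `v |P|`
above the sector bottom. (`v` may be exponentially small in `1/U²`: nodal quasiparticle pairs.) -/
def LandauFloorAt (U δ : ℝ) : Prop :=
  ∃ v η : ℝ, 0 < v ∧ 0 < η ∧ ∀ᶠ k : ℕ in atTop, ∀ s : Bool,
    ∀ P : TorusSite 2 (2 * k + 1 + 1), P ≠ 0 → momentumNormSq (2 * k + 1 + 1) P < η ^ 2 →
      v * Real.sqrt (momentumNormSq (2 * k + 1 + 1) P) ≤
        (hubbardTorus 2 (2 * k + 1 + 1) 1 U).minEnergyOn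
            (szSector (Λ := FermionTorus 2 (2 * k + 1 + 1))
                (if s then 2 * ⌊(1 - δ) * ((2 * k + 1 + 1 : ℕ) : ℝ) ^ 2 / 2⌋₊ + 2
                  else 2 * ⌊(1 - δ) * ((2 * k + 1 + 1 : ℕ) : ℝ) ^ 2 / 2⌋₊ - 2) 0 ⊓
              momentumSubspace (2 * k + 1 + 1) P) -
          (hubbardTorus 2 (2 * k + 1 + 1) 1 U).minEnergyOn
            (szSector (Λ := FermionTorus 2 (2 * k + 1 + 1))
              (if s then 2 * ⌊(1 - δ) * ((2 * k + 1 + 1 : ℕ) : ℝ) ^ 2 / 2⌋₊ + 2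
                else 2 * ⌊(1 - δ) * ((2 * k + 1 + 1 : ℕ) : ℝ) ^ 2 / 2⌋₊ - 2) 0)

/-- `T_c` (INFRARED CEILING, longitudinal, `O(1)` resolution): every normalised `(N_L, 0)` ground state has
`‖Δ_d(m) ψ‖² ≤ C' L² / |q_m|` on a momentum window — the pointwise, weak-coupling-guarded form of item stmt-1089. -/
def InfraredCeilingAt (U δ : ℝ) : Prop :=
  ∃ C η : ℝ, 0 < η ∧ ∀ᶠ k : ℕ in atTop, ∀ ψ : Fock (Orb (FermionTorus 2 (2 * k + 1 + 1))),
    IsGroundStateInSector (hubbardTorus 2 (2 * k + 1 + 1) 1 U) (2 * ⌊(1 - δ) * ((2 * k + 1 + 1 : ℕ) : ℝ) ^ 2 / 2⌋₊) 0 ψ →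
      star ψ ⬝ᵥ ψ = 1 → ∀ m : TorusSite 2 (2 * k + 1 + 1), m ≠ 0 → momentumNormSq (2 * k + 1 + 1) m < η ^ 2 →
        pairStructureFactor dWaveFormFactor (2 * k + 1 + 1) ψ m * Real.sqrt (momentumNormSq (2 * k + 1 + 1) m) ≤
          C * ((2 * k + 1 + 1 : ℕ) : ℝ)

/-- The s2 typing of child T, guarded exactly like the crux (`∃ U₀ ∀ U ∀ δ ∀ μ, DM → Order → …`; constants AFTER `U`). -/
def TransverseLongitudinalT : Prop :=
  ∃ U₀ : ℝ, 0 < U₀ ∧ ∀ U ∈ Ioo (0:ℝ) U₀, ∀ δ ∈ Ioo (0:ℝ) (1 / 2), ∀ μ : ℝ,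
    Tendsto (fun L : ℕ => ((hubbardTorusWith 2 (L + 1) 1 U μ).groundStateFunctional totalNumber).re /
      ((L + 1 : ℕ) : ℝ) ^ 2) atTop (nhds (1 - δ)) → HasDWaveOrder U μ →
      MomentumPurityAt U δ ∧ LandauFloorAt U δ ∧ InfraredCeilingAt U δ

/-- Sanity: translations act on sector ground states of the Hubbard torus (the API the typing leans on). -/
example (U : ℝ) (N : ℕ) (v : TorusSite 2 L) (ψ : Fock (Orb (FermionTorus 2 L)))
    (hψ : IsGroundStateInSector (hubbardTorus 2 L 1 U) N 0 ψ) :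
    IsGroundStateInSector (hubbardTorus 2 L 1 U) N 0 ((fockTranslate (d := 2) v).val *ᵥ ψ) :=
  hψ.fockTranslate_mulVec v (relabel_translate_hubbardTorus v 1 U)

end Summit.HubbardSuperconductivity.HubbardSuperconductivity.Cruxes.WcbcsSsbToTorusLRO.StrategistR1

end
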